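import Summits.ResolutionOfSingularities.ResolutionOfSingularities.Theorems.ValuativeLuAlphaPTorsorPthPowerModMonomialHelpers

/-!
# `p`-th powers modulo a monomial from vanishing log-derivatives — the induction and the base case

Second helper file for the stub `stub_pthPowerModMonomial` of the line `pfaff-line-log-final-forms`
(crux `Valuative.LuAlphaPTorsor`, item `stmt-ResolutionOfSingularities-0641`); notation as in
`ValuativeLuAlphaPTorsorPthPowerModMonomialHelpers.lean` (`u` part of a regular system of
parameters of the local ring `R` with `p = 0`, dual derivations `D_i`, log derivations,
`u^N = CossartPiltant.uPow u N`).

* `exists_sub_pow_mem_span_uPow` — **the abstract theorem**: assume the BASE CASE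
  `hbase : ∀ i₀ x, (∀ δ log, δ x ∈ (u_{i₀})) → ∃ c, x - c^p ∈ (u_{i₀})`. Then for every `M` and
  `a`, if `δ a ∈ (u^M)` for every logarithmic `δ`, there is `c` with `a - c^p ∈ (u^M)`.
  Proof: induction on `|M|`, peeling one factor `u_{i₀}`: `a = c^p + u^{M'} b` (`M' = M - e_{i₀}`);
  then an inner induction (`exists_sub_pow_mem_inner`) on the number of indices `i ≠ i₀` with
  `p ∤ M'_i` using the log derivations `u_i D_i`, the colon formula `((u^M) : u^N) = (u_{i₀})`
  and `exists_eq_pow_mul_add`; when all exponents are divisible by `p`, `u^N = w^p` is killed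
  by every derivation and `hbase` applies to `b` (`exists_sub_pow_mem_of_forall_dvd`).
* `exists_sub_pow_mem_of_rich` — **the base case from a supply of derivations**: if every `ψ`-derivation
  `∂ : R → N` into a commutative ring (`ψ : R →+* N`) agrees on any finite set with a finite
  `N`-combination `y ↦ ∑ ψ(Δ_j y) n_j` of `ℤ`-derivations `Δ_j` of `R`, then `hbase` holds:
  `R/(u_{i₀})` is a regular local ring, hence a normal domain, so if `x̄` is not a `p`-th power
  it is not a `p`-th power in `L = Frac(R/(u_{i₀}))`, and a derivation `∂_L` of `L` with
  `∂_L x̄ = 1` (`exists_derivation_apply_eq_one_of_forall_pow_ne`, Zorn) pulled back to `R`,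
  expanded along the `Δ_j` and corrected by `∑_i Δ_j(u_i) D_i` into log derivations, gives
  `1 = 0` in `L`.
-/

set_option linter.dupNamespace false

namespace Summit.ResolutionOfSingularities.ResolutionOfSingularities.Theorems.PfaffLine

open IsLocalRing Literature.AlgebraicGeometry.Resolution
open Literature.AlgebraicGeometry.Resolution.CossartPiltant (uPow uPow_add uPow_zero uPow_single
  uPow_dvd_uPow_of_le)

universe u

variable {R : Type u} [CommRing R] [Algebra ℤ R]

/-! ## The induction -/

section Induction

variable [IsLocalRing R] {p : ℕ} {d : ℕ} {u : Fin d → R}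
  (hu : IsRsopPart u) {M N : Fin d → ℕ} {i₀ : Fin d} (hN₀ : N i₀ + 1 = M i₀)
  (hMN : ∀ i, i ≠ i₀ → M i ≤ N i)
  (hp : p.Prime) (hpR : (p : R) = 0) (D : Fin d → Derivation ℤ R R)
  (hD : ∀ i j, D i (u j) = if i = j then 1 else 0)
  (hbase : ∀ (i₀ : Fin d) (x : R), (∀ δ : Derivation ℤ R R, (∀ i, δ (u i) ∈ Ideal.span {u i}) →
    δ x ∈ Ideal.span {u i₀}) → ∃ c, x - c ^ p ∈ Ideal.span {u i₀})

include hu hN₀ hMN hp hpR hD hbase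

/-- **Inner step, all other exponents divisible by `p`.** [folklore] -/
theorem exists_sub_pow_mem_of_forall_dvd (hdvd : ∀ i, i ≠ i₀ → p ∣ N i) (b : R)
    (hb : ∀ δ : Derivation ℤ R R, (∀ i, δ (u i) ∈ Ideal.span {u i}) →
      δ (uPow u N * b) ∈ Ideal.span {uPow u M}) :
    ∃ c, uPow u N * b - c ^ p ∈ Ideal.span {uPow u M} := by
  have hcolon := fun y => uPow_mul_mem_iff hu hN₀ hMN y
  have hmem := uPow_mul_self_mem (u := u) hN₀ hMN
  by_cases hi₀ : p ∣ N i₀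
  · -- `u^N = w^p` is killed by every derivation, so `δ b ∈ (u_{i₀})` for all log `δ`
    have hall : ∀ i, p ∣ N i := fun i => by
      by_cases hi : i = i₀
      · subst hi; exact hi₀
      · exact hdvd i hi
    set w : R := uPow u fun i => N i / p with hw
    have hwp : w ^ p = uPow u N := by
      rw [hw, uPow, uPow, ← Finset.prod_pow]
      exact Finset.prod_congr rfl fun i _ => by rw [← pow_mul, Nat.div_mul_cancel (hall i)]
    have hb' : ∀ δ : Derivation ℤ R R, (∀ i, δ (u i) ∈ Ideal.span {u i}) →
        δ b ∈ Ideal.span {u i₀} := by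
      intro δ hδ
      have h := hb δ hδ
      rw [Derivation.leibniz, ← hwp, derivation_apply_pow_eq_zero hpR, smul_zero, add_zero,
        smul_eq_mul, hwp] at h
      exact (hcolon _).mp h
    obtain ⟨e, he⟩ := hbase i₀ b hb'
    obtain ⟨g, hg⟩ := Ideal.mem_span_singleton'.mp he
    refine ⟨w * e, ?_⟩
    have : uPow u N * b - (w * e) ^ p = (uPow u N * u i₀) * g := by
      rw [mul_pow, hwp, mul_assoc, mul_comm (u i₀) g, hg]; ring
    rw [this]
    exact Ideal.mul_mem_right _ _ hmem
  · -- `p ∤ N_{i₀}`: the log derivation `u_{i₀} D_{i₀}` shows `b ∈ (u_{i₀})`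
    have h := hb _ (smul_dual_log u D hD i₀)
    rw [smul_dual_apply_uPow_mul u D hD, hcolon] at h
    have h2 : (N i₀ : R) * b ∈ Ideal.span {u i₀} := by
      have : (N i₀ : R) * b = ((N i₀ : R) * b + u i₀ * D i₀ b) - u i₀ * D i₀ b := by ring
      rw [this]
      exact Ideal.sub_mem _ h (Ideal.mul_mem_right _ _ (Ideal.mem_span_singleton_self _))
    obtain ⟨v, hv⟩ := isUnit_natCast_of_not_dvd hp hpR hi₀
    have hb2 : b ∈ Ideal.span {u i₀} := by
      have : b = (↑v⁻¹ : R) * ((N i₀ : R) * b) := by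
        rw [← hv, ← mul_assoc, Units.inv_mul, one_mul]
      rw [this]
      exact Ideal.mul_mem_left _ _ h2
    obtain ⟨g, hg⟩ := Ideal.mem_span_singleton'.mp hb2
    refine ⟨0, ?_⟩
    rw [zero_pow hp.ne_zero, sub_zero, ← hg, mul_comm g, ← mul_assoc]
    exact Ideal.mul_mem_right _ _ hmem

omit hN₀ hMN in
/-- **Inner induction** on the number of indices `i ≠ i₀` with `p ∤ N_i`: for such an `i₁`,
`u_{i₁} D_{i₁}` gives `N_{i₁} b + u_{i₁} D_{i₁} b ∈ (u_{i₀})`, hence `b = u_{i₁}^t b₀ + u_{i₀} g`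
with `p ∣ N_{i₁} + t`, and `u^N b ≡ u^{N + t e_{i₁}} b₀ mod (u^M)`. [folklore] -/
theorem exists_sub_pow_mem_inner (n : ℕ) :
    ∀ (N : Fin d → ℕ) (b : R), (Finset.univ.filter fun i => i ≠ i₀ ∧ ¬ p ∣ N i).card ≤ n →
      N i₀ + 1 = M i₀ → (∀ i, i ≠ i₀ → M i ≤ N i) →
      (∀ δ : Derivation ℤ R R, (∀ i, δ (u i) ∈ Ideal.span {u i}) →
        δ (uPow u N * b) ∈ Ideal.span {uPow u M}) →
      ∃ c, uPow u N * b - c ^ p ∈ Ideal.span {uPow u M} := by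
  classical
  induction n with
  | zero =>
    intro N b hcard hN₀ hMN hb
    refine exists_sub_pow_mem_of_forall_dvd (hu := hu) (hN₀ := hN₀) (hMN := hMN) hp hpR D hD
      hbase (fun i hi => ?_) b hb
    by_contra hndvd
    have : i ∈ Finset.univ.filter fun i => i ≠ i₀ ∧ ¬ p ∣ N i :=
      Finset.mem_filter.mpr ⟨Finset.mem_univ _, hi, hndvd⟩
    exact Finset.card_ne_zero_of_mem this (Nat.le_zero.mp hcard)
  | succ n ih =>
    intro N b hcard hN₀ hMN hb
    by_cases hex : ∃ i₁, i₁ ≠ i₀ ∧ ¬ p ∣ N i₁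
    · obtain ⟨i₁, h10, hndvd⟩ := hex
      have hcolon := fun y => uPow_mul_mem_iff hu hN₀ hMN y
      have hmem := uPow_mul_self_mem (u := u) hN₀ hMN
      have h := hb _ (smul_dual_log u D hD i₁)
      rw [smul_dual_apply_uPow_mul u D hD, hcolon] at h
      obtain ⟨t, b₀, g, hpt, hbeq⟩ := exists_eq_pow_mul_add hp hpR hu D hD h10 hndvd h
      set N' : Fin d → ℕ := N + Pi.single i₁ t with hN'
      have hdiff : uPow u N * b - uPow u N' * b₀ = uPow u N * u i₀ * g := by
        rw [hN', uPow_add, hbeq]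
        have : uPow u (Pi.single i₁ t) = u i₁ ^ t := by
          rw [uPow, Finset.prod_eq_single i₁ (fun j _ hj => by rw [Pi.single_eq_of_ne hj, pow_zero])
            (fun h => absurd (Finset.mem_univ _) h), Pi.single_eq_same]
        rw [this]; ring
      have hdiff_mem : uPow u N * b - uPow u N' * b₀ ∈ Ideal.span {uPow u M} := by
        rw [hdiff]; exact Ideal.mul_mem_right _ _ hmem
      -- the induction hypothesis applies to `(N', b₀)`
      have hN'i₀ : N' i₀ = N i₀ := by
        rw [hN', Pi.add_apply, Pi.single_eq_of_ne (Ne.symm h10), add_zero]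
      have hcard' : (Finset.univ.filter fun i => i ≠ i₀ ∧ ¬ p ∣ N' i).card ≤ n := by
        have hsub : (Finset.univ.filter fun i => i ≠ i₀ ∧ ¬ p ∣ N' i) ⊆
            (Finset.univ.filter fun i => i ≠ i₀ ∧ ¬ p ∣ N i).erase i₁ := by
          intro i hi
          obtain ⟨-, hi0, hip⟩ := Finset.mem_filter.mp hi
          have hii₁ : i ≠ i₁ := by
            rintro rfl
            apply hip
            rw [hN', Pi.add_apply, Pi.single_eq_same]
            exact hpt
          rw [hN', Pi.add_apply, Pi.single_eq_of_ne hii₁, add_zero] at hip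
          exact Finset.mem_erase.mpr ⟨hii₁, Finset.mem_filter.mpr ⟨Finset.mem_univ _, hi0, hip⟩⟩
        have hi₁mem : i₁ ∈ Finset.univ.filter fun i => i ≠ i₀ ∧ ¬ p ∣ N i :=
          Finset.mem_filter.mpr ⟨Finset.mem_univ _, h10, hndvd⟩
        have := Finset.card_le_card hsub
        rw [Finset.card_erase_of_mem hi₁mem] at this
        omega
      have hb' : ∀ δ : Derivation ℤ R R, (∀ i, δ (u i) ∈ Ideal.span {u i}) →
          δ (uPow u N' * b₀) ∈ Ideal.span {uPow u M} := by
        intro δ hδ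
        have h1 : uPow u N' * b₀ = uPow u N * b - (uPow u N * b - uPow u N' * b₀) := by ring
        rw [h1, map_sub]
        exact Ideal.sub_mem _ (hb δ hδ) (derivation_mem_span_uPow u δ hδ M hdiff_mem)
      obtain ⟨c, hc⟩ := ih N' b₀ hcard' (by rw [hN'i₀]; exact hN₀)
        (fun i hi => (hMN i hi).trans (by rw [hN', Pi.add_apply]; exact Nat.le_add_right _ _)) hb'
      refine ⟨c, ?_⟩
      have : uPow u N * b - c ^ p = (uPow u N * b - uPow u N' * b₀) + (uPow u N' * b₀ - c ^ p) := by
        ring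
      rw [this]
      exact Ideal.add_mem _ hdiff_mem hc
    · push Not at hex
      exact exists_sub_pow_mem_of_forall_dvd (hu := hu) (hN₀ := hN₀) (hMN := hMN) hp hpR D hD
        hbase hex b hb

omit hN₀ hMN in
/-- **`p`-th powers modulo a monomial from vanishing log-derivatives, abstract form.** Let
`u` be part of a regular system of parameters of the local ring `R` (`p = 0` in `R`, `p`
prime) with dual derivations `D_i` (`D_i u_j = δ_ij`), and assume the base case `hbase` (a
residue modulo `(u_{i₀})` all of whose log-derivatives vanish is a `p`-th power modulo
`(u_{i₀})`). If `δ a ∈ (u^M)` for every derivation `δ` with `δ u_i ∈ (u_i)` for all `i`, then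
`a ≡ c^p mod (u^M)` for some `c`. Induction on `|M|`. [folklore] -/
theorem exists_sub_pow_mem_span_uPow (M : Fin d → ℕ) (a : R)
    (ha : ∀ δ : Derivation ℤ R R, (∀ i, δ (u i) ∈ Ideal.span {u i}) →
      δ a ∈ Ideal.span {uPow u M}) :
    ∃ c, a - c ^ p ∈ Ideal.span {uPow u M} := by
  classical
  haveI : Fact p.Prime := ⟨hp⟩
  haveI : CharP R p := (CharP.charP_iff_prime_eq_zero hp).mpr hpR
  suffices key : ∀ (s : ℕ) (M : Fin d → ℕ) (a : R), ∑ i, M i = s →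
      (∀ δ : Derivation ℤ R R, (∀ i, δ (u i) ∈ Ideal.span {u i}) →
        δ a ∈ Ideal.span {uPow u M}) → ∃ c, a - c ^ p ∈ Ideal.span {uPow u M} from
    key _ M a rfl ha
  intro s
  induction s with
  | zero =>
    intro M a hs _
    have hM : M = 0 := funext fun i => (Finset.sum_eq_zero_iff.mp hs) i (Finset.mem_univ _)
    refine ⟨0, ?_⟩
    rw [hM, uPow_zero, Ideal.span_singleton_one]
    exact Submodule.mem_top
  | succ s ih =>
    intro M a hs ha
    obtain ⟨i₀, hi₀⟩ : ∃ i₀, M i₀ ≠ 0 := by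
      by_contra hcon
      push Not at hcon
      rw [Finset.sum_eq_zero fun i _ => hcon i] at hs
      exact Nat.succ_ne_zero s hs.symm
    set M' : Fin d → ℕ := Function.update M i₀ (M i₀ - 1) with hM'
    have hM'i₀ : M' i₀ + 1 = M i₀ := by
      rw [hM', Function.update_self]; omega
    have hM'eq : ∀ i, i ≠ i₀ → M' i = M i := fun i hi => by
      rw [hM', Function.update_of_ne hi]
    have hM'i : ∀ i, i ≠ i₀ → M i ≤ M' i := fun i hi => (hM'eq i hi).ge
    have hsum : ∑ i, M' i = s := by
      have h1 := Finset.sum_update_of_mem (Finset.mem_univ i₀) M (M i₀ - 1)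
      have h2 : ∑ i, M i = M i₀ + ∑ i ∈ Finset.univ \ {i₀}, M i := by
        rw [← Finset.add_sum_erase _ _ (Finset.mem_univ i₀), Finset.sdiff_singleton_eq_erase]
      rw [hM', h1]
      omega
    -- `(u^M) ⊆ (u^{M'})`
    have hle : Ideal.span {uPow u M} ≤ Ideal.span {uPow u M'} :=
      Ideal.span_singleton_le_span_singleton.mpr (uPow_dvd_uPow_of_le u fun i => by
        by_cases hi : i = i₀
        · rw [hi]; exact hM'i₀ ▸ Nat.le_succ (M' i₀)
        · exact (hM'eq i hi).le)
    obtain ⟨c, hc⟩ := ih M' a hsum fun δ hδ => hle (ha δ hδ)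
    obtain ⟨b, hb⟩ := Ideal.mem_span_singleton'.mp hc
    -- the inner induction for `u^{M'} b = a - c^p`
    have hb' : ∀ δ : Derivation ℤ R R, (∀ i, δ (u i) ∈ Ideal.span {u i}) →
        δ (uPow u M' * b) ∈ Ideal.span {uPow u M} := by
      intro δ hδ
      rw [mul_comm, hb, map_sub, derivation_apply_pow_eq_zero hpR, sub_zero]
      exact ha δ hδ
    obtain ⟨c', hc'⟩ := exists_sub_pow_mem_inner (hu := hu) hp hpR D hD hbase d M' b
      ((Finset.card_le_univ _).trans (by rw [Fintype.card_fin])) hM'i₀ hM'i hb'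
    refine ⟨c + c', ?_⟩
    have : a - (c + c') ^ p = uPow u M' * b - c' ^ p := by
      rw [add_pow_char, mul_comm, hb]; ring
    rw [this]
    exact hc'

end Induction


/-! ## The base case from a supply of derivations -/

section Base

variable [IsLocalRing R] {p : ℕ} {d : ℕ} {u : Fin d → R}

omit [IsLocalRing R] in
/-- Evaluating a finite sum of derivations. [folklore] -/
theorem derivation_finset_sum_apply {ι : Type*} (s : Finset ι) (f : ι → Derivation ℤ R R)
    (y : R) : (∑ l ∈ s, f l) y = ∑ l ∈ s, f l y := by
  induction s using Finset.cons_induction with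
  | empty => simp
  | cons a s ha ih => rw [Finset.sum_cons, Finset.sum_cons, Derivation.add_apply, ih]

/-- **The base case from a supply of derivations.** Let `u` be part of a regular system of
parameters of `R` (`p = 0` in `R`) with dual derivations `D_i`, and suppose every
`ψ`-derivation `∂ : R → N` (`ψ : R →+* N` a ring homomorphism, `∂` additive with
`∂(ab) = ψ(a)∂(b) + ψ(b)∂(a)`) agrees on any finite set with `y ↦ ∑_j ψ(Δ_j y) n_j` for finitely
many `ℤ`-derivations `Δ_j` of `R` and `n_j ∈ N`. If `δ x ∈ (u_{i₀})` for every log derivation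
`δ`, then `x ≡ c^p mod (u_{i₀})` for some `c`: otherwise `x̄ ∈ R/(u_{i₀})` (a regular local
ring, hence a normal domain) is not a `p`-th power in `L = Frac(R/(u_{i₀}))`, a derivation `∂_L`
of `L` with `∂_L(x̄) = 1` exists, and expanding `∂_L ∘ ψ` along the `Δ_j`, corrected into the
log derivations `Δ_j - ∑_i Δ_j(u_i) D_i` and `u_i D_i`, yields `1 = ψ(D_{i₀} x) ∂_L(ψ u_{i₀}) = 0`.
[folklore] -/
theorem exists_sub_pow_mem_of_rich (hp : p.Prime) (hpR : (p : R) = 0) (hu : IsRsopPart u)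
    (D : Fin d → Derivation ℤ R R) (hD : ∀ i j, D i (u j) = if i = j then 1 else 0)
    (hrich : ∀ (N : Type u) [CommRing N] (ψ : R →+* N) (δ₀ : R →+ N),
      (∀ a b, δ₀ (a * b) = ψ a * δ₀ b + ψ b * δ₀ a) → ∀ Y : Finset R,
      ∃ (m : ℕ) (Δ : Fin m → Derivation ℤ R R) (n : Fin m → N),
        ∀ y ∈ Y, δ₀ y = ∑ j, ψ (Δ j y) * n j)
    (i₀ : Fin d) (x : R)
    (hx : ∀ δ : Derivation ℤ R R, (∀ i, δ (u i) ∈ Ideal.span {u i}) →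
      δ x ∈ Ideal.span {u i₀}) :
    ∃ c, x - c ^ p ∈ Ideal.span {u i₀} := by
  classical
  haveI : Fact p.Prime := ⟨hp⟩
  set 𝔭 : Ideal R := Ideal.span {u i₀} with h𝔭
  -- `R/𝔭` is regular local, hence a normal domain
  have hpart : IsRsopPart (fun _ : Fin 1 => u i₀) :=
    hu.comp (fun _ => i₀) (fun a b _ => Subsingleton.elim a b)
  have hrange : Set.range (fun _ : Fin 1 => u i₀) = {u i₀} := by
    ext a
    simp only [Set.mem_range, exists_const, Set.mem_singleton_iff]
    exact eq_comm
  haveI hreg : IsRegularLocalRing (R ⧸ 𝔭) := by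
    have := hpart.isRegularLocalRing_quotient
    rwa [hrange] at this
  haveI : IsDomain (R ⧸ 𝔭) := isDomain_of_isRegularLocalRing _
  haveI : IsIntegrallyClosed (R ⧸ 𝔭) := isIntegrallyClosed_of_isRegularLocalRing _
  have hpQ : (p : R ⧸ 𝔭) = 0 := by rw [← map_natCast (Ideal.Quotient.mk 𝔭), hpR, map_zero]
  have hpL : (p : FractionRing (R ⧸ 𝔭)) = 0 := by
    rw [← map_natCast (algebraMap (R ⧸ 𝔭) (FractionRing (R ⧸ 𝔭))), hpQ, map_zero]
  haveI : CharP (FractionRing (R ⧸ 𝔭)) p := (CharP.charP_iff_prime_eq_zero hp).mpr hpL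
  by_contra hcon
  push Not at hcon
  set ψ : R →+* FractionRing (R ⧸ 𝔭) :=
    (algebraMap (R ⧸ 𝔭) (FractionRing (R ⧸ 𝔭))).comp (Ideal.Quotient.mk 𝔭) with hψ
  have hψ0 : ∀ y, y ∈ 𝔭 → ψ y = 0 := fun y hy => by
    rw [hψ, RingHom.comp_apply, Ideal.Quotient.eq_zero_iff_mem.mpr hy, map_zero]
  have hψu : ψ (u i₀) = 0 := hψ0 _ (Ideal.mem_span_singleton_self _)
  -- `ψ x` is not a `p`-th power in the fraction field (normality)
  have hnot : ∀ ℓ : FractionRing (R ⧸ 𝔭), ℓ ^ p ≠ ψ x := by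
    intro ℓ hℓ
    have hint : IsIntegral (R ⧸ 𝔭) ℓ := by
      refine ⟨Polynomial.X ^ p - Polynomial.C (Ideal.Quotient.mk 𝔭 x),
        Polynomial.monic_X_pow_sub_C _ hp.ne_zero, ?_⟩
      rw [Polynomial.eval₂_sub, Polynomial.eval₂_X_pow, Polynomial.eval₂_C, hℓ, hψ,
        RingHom.comp_apply, sub_self]
    obtain ⟨y, hy⟩ := IsIntegrallyClosed.algebraMap_eq_of_integral hint
    obtain ⟨c, rfl⟩ := Ideal.Quotient.mk_surjective y
    refine hcon c (Ideal.Quotient.eq.mp ?_)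
    apply IsFractionRing.injective (R ⧸ 𝔭) (FractionRing (R ⧸ 𝔭))
    rw [map_pow, map_pow, hy, hℓ, hψ, RingHom.comp_apply]
  obtain ⟨dL, hdL⟩ :=
    Literature.FieldTheory.Separability.exists_derivation_apply_eq_one_of_forall_pow_ne p (ψ x) hnot
  -- pull back to a `ψ`-derivation of `R` and expand
  let δ₀ : R →+ FractionRing (R ⧸ 𝔭) :=
    { toFun := fun y => dL (ψ y)
      map_zero' := by rw [map_zero, map_zero]
      map_add' := fun a b => by rw [map_add, map_add] }
  have hδ₀apply : ∀ y, δ₀ y = dL (ψ y) := fun y => rfl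
  -- Leibniz rule of `dL` (instances read off the type of `dL`, not re-synthesized: the
  -- fraction field carries two `ℤ`-algebra structures)
  have hleibL : ∀ a b : FractionRing (R ⧸ 𝔭), dL (a * b) = a * dL b + b * dL a := fun a b =>
    @Derivation.leibniz ℤ (FractionRing (R ⧸ 𝔭)) (FractionRing (R ⧸ 𝔭)) _ _ _ (_) _ _ dL a b
  have hleib : ∀ a b, δ₀ (a * b) = ψ a * δ₀ b + ψ b * δ₀ a := fun a b => by
    rw [hδ₀apply, hδ₀apply, hδ₀apply, map_mul, hleibL]
  obtain ⟨m, Δ, n, hΔ⟩ := hrich (FractionRing (R ⧸ 𝔭)) ψ δ₀ hleib {x, u i₀}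
  -- the corrected derivations `Δ_j - ∑_l Δ_j(u_l) D_l` are logarithmic
  have hcorr : ∀ j y, (Δ j - ∑ l, Δ j (u l) • D l) y = Δ j y - ∑ l, Δ j (u l) * D l y := by
    intro j y
    rw [Derivation.sub_apply, derivation_finset_sum_apply]
    rfl
  have hlog : ∀ j i, (Δ j - ∑ l, Δ j (u l) • D l) (u i) ∈ Ideal.span {u i} := by
    intro j i
    rw [hcorr]
    simp only [hD, mul_ite, mul_one, mul_zero, Finset.sum_ite_eq', Finset.mem_univ, if_true,
      sub_self]
    exact zero_mem _
  have hψΔ' : ∀ j, ψ (Δ j x) = ∑ l, ψ (Δ j (u l)) * ψ (D l x) := by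
    intro j
    have h1 := hψ0 _ (hx _ (hlog j))
    rw [hcorr, map_sub, sub_eq_zero, map_sum] at h1
    rw [h1]
    exact Finset.sum_congr rfl fun l _ => map_mul ψ _ _
  -- `D_l x ∈ 𝔭` for `l ≠ i₀` (test with the log derivation `u_l D_l`)
  have hDl : ∀ l, l ≠ i₀ → ψ (D l x) = 0 := by
    intro l hl
    apply hψ0
    have h1 := hx _ (smul_dual_log u D hD l)
    rw [Derivation.smul_apply, smul_eq_mul] at h1
    have hprime : 𝔭.IsPrime := by
      have := hpart.isPrime_span_range
      rwa [hrange] at this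
    refine (hprime.mem_or_mem h1).resolve_left fun hmem => ?_
    have h2 := hu.not_mem_span_image (S := {i₀}) (i := l) (by simpa using hl)
    rw [Set.image_singleton] at h2
    exact h2 hmem
  -- `1 = dL (ψ x) = ψ (D_{i₀} x) · dL (ψ u_{i₀}) = 0`
  have hx1 : dL (ψ x) = ψ (D i₀ x) * dL (ψ (u i₀)) := by
    have e1 : dL (ψ x) = δ₀ x := rfl
    have e2 : dL (ψ (u i₀)) = δ₀ (u i₀) := rfl
    rw [e1, e2, hΔ x (Finset.mem_insert_self _ _),
      hΔ (u i₀) (Finset.mem_insert_of_mem (Finset.mem_singleton_self _)), Finset.mul_sum]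
    refine Finset.sum_congr rfl fun j _ => ?_
    rw [hψΔ' j, Finset.sum_eq_single i₀ (fun l _ hl => by rw [hDl l hl, mul_zero])
      (fun h => absurd (Finset.mem_univ _) h)]
    ring
  rw [hdL, hψu, map_zero, mul_zero] at hx1
  exact one_ne_zero hx1

end Base

/-- **Registered sub-goal `pthPowerModMonomial_of_base_case`** (closed form of
`exists_sub_pow_mem_span_uPow`, for `--supports` registration): `p`-th powers modulo a monomial
from vanishing log-derivatives, given dual derivations and the base case. [folklore] -/
theorem pthPowerModMonomial_of_base_case : ∀ {R : Type*} [CommRing R] [Algebra ℤ R] [IsLocalRing R] {p d : ℕ} {u : Fin d → R}, Literature.AlgebraicGeometry.Resolution.IsRsopPart u → p.Prime → (p : R) = 0 → ∀ (D : Fin d → Derivation ℤ R R), (∀ i j, D i (u j) = if i = j then 1 else 0) → (∀ (i₀ : Fin d) (x : R), (∀ δ : Derivation ℤ R R, (∀ i, δ (u i) ∈ Ideal.span {u i}) → δ x ∈ Ideal.span {u i₀}) → ∃ c, x - c ^ p ∈ Ideal.span {u i₀}) → ∀ (M : Fin d → ℕ) (a : R), (∀ δ : Derivation ℤ R R, (∀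 i, δ (u i) ∈ Ideal.span {u i}) → δ a ∈ Ideal.span {Literature.AlgebraicGeometry.Resolution.CossartPiltant.uPow u M}) → ∃ c, a - c ^ p ∈ Ideal.span {Literature.AlgebraicGeometry.Resolution.CossartPiltant.uPow u M} :=
  fun hu hp hpR D hD hbase M a ha => exists_sub_pow_mem_span_uPow hu hp hpR D hD hbase M a ha

end Summit.ResolutionOfSingularities.ResolutionOfSingularities.Theorems.PfaffLine
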